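import Summits.QuantumAdvantage.AdviceFreeQNC0.AffineStakesCalc
import Summits.QuantumAdvantage.AdviceFreeQNC0.HardcoreToggle
import Summits.QuantumAdvantage.AdviceFreeQNC0.WalkTubeRank
import HarnessLib

/-!
# Cell qa-qnc0 — affine stakes: the four local mechanisms (planner qa-qnc0-p1 g19, ROUND-18 §3.6,
steps (3), (4a)–(4d); service file for `AffineStakesHard.lean`)

* `card_win_le_of_changed` — loss ≥ ½·influence in the form used by the assembly: an injective
  odd-class-preserving move changing the win bit on all of `D` forces `2·#WIN + #D ≤ 2·2^{n-1}`;
* `isRadiusOne_of_not_far` (step 3) — if no row of the read matrix distinguishes two far-apart coins at a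
  far bell (the negation of the case killed by the toggle lemma), every row `A k` is supported on
  `{k-1, k, k+1}`: rows are constant off `N[k]` (two far positions are linked through a third one, `n ≥ 10`)
  and the constant is `0` by the weight bound `(log₂ n)^c + 4 ≤ n` (`logPow_add_four_le`);
* `coinPair_flips` (step 4a) — radius 1, particles `a, b` with `κ_a ≠ κ_b`: the coin-pair flip changes
  the win bit (`wval_flipAt`, `colSum_particle`);
* `creation_flips` (steps 4b, 4c) — radius 1, on the cylinder `J_{s-2} = J_{s-1} = J_s = J_{s+1} = 1`,
  `J_{s+2} = b₀` with `e_s + κ_{s-1} + b₀ κ_{s+1} = 1`: the creation move at `s` changes the win bit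
  (`kline_create`, `wval_flipAt_left`, forcing equations);
* `wval_null` (step 4d) — radius 1, `κ ≡ 0`, `e ≡ 0`: the pairing vanishes identically (the NULL family;
  same telescoping as `dot2_nullAffine_of_inKernel`, in coefficient form);
* `exists_far_pair_of_kap_ne`, `kap_const_of_forall` — a non-constant `κ` on the cycle has two values
  differing at non-adjacent positions.

WHAT THIS IS NOT: the assembly `AffineStakesHardOdd3` is the next file; crux 22907 untouched;
separation NOT moved.
-/

namespace Summit.QuantumAdvantage.AdviceFreeQNC0.Fib19

open Finset Literature.Computability.QuantumComplexity Literature.Computability.QuantumComplexity.RingHLF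

variable {n : ℕ}

/-- `e_s = c_s + β_{s-1} + β_{s+1} + α_s + γ_s`: the constant part of the win-bit change under the creation
move at `s` for a radius-1 affine strategy (`β_k = A k k`, `α_k = A k (k-1)`, `γ_k = A k (k+1)`). -/
def eps (A : Fin n → Fin n → Bool) (cv : Fin n → Bool) (s : Fin n) : ZMod 2 :=
  bitVal (cv s) + bitVal (A (prv s) (prv s)) + bitVal (A (nxt s) (nxt s)) + bitVal (A s (prv s)) +
    bitVal (A s (nxt s))

/-! ### Loss ≥ ½·influence, assembly form -/

/-- If an injective odd-class-preserving move `M` changes the win bit on ALL of `D`, then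
`2·#{x odd : WIN} + #D ≤ 2·2^{n-1}` (`card_changed_le_two_mul_card_lose` + `card_isOdd`). -/
theorem card_win_le_of_changed (hn : 1 ≤ n) (z : (Fin n → Bool) → (Fin n → Bool))
    (M : (Fin n → Bool) → (Fin n → Bool)) (D : Finset (Fin n → Bool))
    (hD : ∀ x ∈ D, IsOdd x ∧ IsOdd (M x)) (hinj : Set.InjOn M ↑D)
    (hch : ∀ x ∈ D, ¬ (Rel x (z x) ↔ Rel (M x) (z (M x)))) :
    2 * (univ.filter fun x : Fin n → Bool => IsOdd x ∧ Rel x (z x)).card + D.card ≤ 2 * 2 ^ (n - 1) := by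
  have h1 := card_changed_le_two_mul_card_lose z M D hD hinj
  rw [Finset.filter_true_of_mem hch] at h1
  have h2 : (univ.filter fun x : Fin n → Bool => IsOdd x ∧ Rel x (z x)).card +
      (univ.filter fun x : Fin n → Bool => IsOdd x ∧ ¬ Rel x (z x)).card = 2 ^ (n - 1) := by
    rw [← card_isOdd hn, ← Finset.card_filter_add_card_filter_not (s := univ.filter fun x : Fin n → Bool =>
      IsOdd x) (fun x => Rel x (z x)), filter_filter, filter_filter]
  omega

/-! ### Cyclic distance in the `≠` form -/

/-- `q ≠ p` and `q ≠ p + 1` give cyclic distance `≥ 2` from `p` to `q` (the hypothesis form of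
`HardcoreToggle`). -/
theorem two_le_dist_of_ne {p q : Fin n} (h0 : q ≠ p) (h1 : q ≠ nxt p) : 2 ≤ (q.val + n - p.val) % n := by
  by_contra hlt
  push Not at hlt
  have hp := p.isLt
  have hq := q.isLt
  by_cases hle : p.val ≤ q.val
  · have hmod : (q.val + n - p.val) % n = q.val - p.val := by
      rw [show q.val + n - p.val = (q.val - p.val) + n from by omega, Nat.add_mod_right,
        Nat.mod_eq_of_lt (by omega)]
    rw [hmod] at hlt
    rcases (show q.val = p.val ∨ q.val = p.val + 1 from by omega) with h | h
    · exact h0 (Fin.ext h)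
    · apply h1
      apply Fin.ext
      show q.val = (p.val + 1) % n
      rw [Nat.mod_eq_of_lt (by omega)]; exact h
  · have hmod : (q.val + n - p.val) % n = q.val + n - p.val := Nat.mod_eq_of_lt (by omega)
    rw [hmod] at hlt
    apply h1
    apply Fin.ext
    show q.val = (p.val + 1) % n
    rw [show p.val + 1 = n from by omega, Nat.mod_self]
    omega

/-! ### Step (3): no far disagreement ⇒ radius 1 -/

/-- `(log₂ n)^c + 4 ≤ n` for all large `n` (cell lemma `TubePlanProof.logPow_le_natSqrt`). -/
theorem logPow_add_four_le (c : ℕ) : ∃ n₀ : ℕ, ∀ n ≥ n₀, (Nat.log 2 n) ^ c + 4 ≤ n := by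
  obtain ⟨n₀, h⟩ := TubePlanProof.logPow_le_natSqrt c
  refine ⟨max n₀ 36, fun n hn => ?_⟩
  have h1 := h n (le_trans (le_max_left _ _) hn)
  have h36 : 36 ≤ n := le_trans (le_max_right _ _) hn
  have hs : Nat.sqrt n * Nat.sqrt n ≤ n := Nat.sqrt_le n
  have h6 : 6 ≤ Nat.sqrt n := by rw [Nat.le_sqrt]; omega
  nlinarith

/-- **Step (3).** If no bell `k` distinguishes two coins `p, p'` that are far from each other and from `k`
(the situation excluded by the toggle lemma), and the rows have weight `≤ (log₂ n)^c ≤ n - 4`, then the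
read matrix has radius 1. -/
theorem isRadiusOne_of_not_far (hn : 10 ≤ n) (A : Fin n → Fin n → Bool) (c : ℕ)
    (hw : ∀ j, rowWeight A j ≤ (Nat.log 2 n) ^ c) (hlog : (Nat.log 2 n) ^ c + 4 ≤ n)
    (hfar : ¬ ∃ p p' k : Fin n, p' ≠ prv p ∧ p' ≠ p ∧ p' ≠ nxt p ∧ k ≠ prv p ∧ k ≠ p ∧ k ≠ nxt p ∧
        k ≠ prv p' ∧ k ≠ p' ∧ k ≠ nxt p' ∧ A k p ≠ A k p') : IsRadiusOne A := by
  intro k i h1 h2 h3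
  by_contra hki
  rw [Bool.not_eq_false] at hki
  push Not at hfar
  -- every position far from `k` carries a `1` in row `k`
  have key : ∀ j, j ≠ prv k → j ≠ k → j ≠ nxt k → A k j = true := by
    intro j hj1 hj2 hj3
    have hbig : (({prv k, k, nxt k} ∪ ({prv i, i, nxt i} ∪ {prv j, j, nxt j}) : Finset (Fin n))ᶜ).Nonempty := by
      rw [← card_pos, card_compl, Fintype.card_fin]
      have hc : (({prv k, k, nxt k} ∪ ({prv i, i, nxt i} ∪ {prv j, j, nxt j}) : Finset (Fin n))).card ≤ 9 :=
        (card_union_le _ _).trans (by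
          have ha : ({prv k, k, nxt k} : Finset (Fin n)).card ≤ 3 := card_le_three
          have hb : (({prv i, i, nxt i} ∪ {prv j, j, nxt j}) : Finset (Fin n)).card ≤ 6 :=
            (card_union_le _ _).trans (add_le_add card_le_three card_le_three)
          omega)
      omega
    obtain ⟨m, hm⟩ := hbig
    simp only [mem_compl, mem_union, mem_insert, mem_singleton, not_or] at hm
    obtain ⟨⟨hmk1, hmk2, hmk3⟩, ⟨hmi1, hmi2, hmi3⟩, ⟨hmj1, hmj2, hmj3⟩⟩ := hm
    obtain ⟨hki1, hki2, hki3⟩ := far_symm h1 h2 h3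
    obtain ⟨hkm1, hkm2, hkm3⟩ := far_symm hmk1 hmk2 hmk3
    obtain ⟨hkj1, hkj2, hkj3⟩ := far_symm hj1 hj2 hj3
    obtain ⟨hjm1, hjm2, hjm3⟩ := far_symm hmj1 hmj2 hmj3
    have e1 : A k i = A k m := hfar i m k hmi1 hmi2 hmi3 hki1 hki2 hki3 hkm1 hkm2 hkm3
    have e2 : A k m = A k j := hfar m j k hjm1 hjm2 hjm3 hkm1 hkm2 hkm3 hkj1 hkj2 hkj3
    rw [← e2, ← e1]; exact hki
  have hsub : (({prv k, k, nxt k} : Finset (Fin n))ᶜ) ⊆ univ.filter fun j => A k j = true := by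
    intro j hj
    simp only [mem_compl, mem_insert, mem_singleton, not_or] at hj
    exact mem_filter.2 ⟨mem_univ _, key j hj.1 hj.2.1 hj.2.2⟩
  have hcard := card_le_card hsub
  rw [card_compl, Fintype.card_fin] at hcard
  have h3' : ({prv k, k, nxt k} : Finset (Fin n)).card ≤ 3 := card_le_three
  have hwk := hw k
  unfold rowWeight at hwk
  omega

/-! ### κ on the cycle -/

/-- If `κ` agrees on all adjacent pairs it is constant. -/
theorem kap_const_of_forall (A : Fin n → Fin n → Bool) (h : ∀ q, kap A (nxt q) = kap A q) (i j : Fin n) :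
    kap A i = kap A j := by
  have key : ∀ m : ℕ, ∀ q : Fin n, kap A ((nxt^[m]) q) = kap A q := by
    intro m
    induction m with
    | zero => intro q; rfl
    | succ m ih => intro q; rw [Function.iterate_succ_apply', h, ih]
  obtain ⟨m, hm⟩ := exists_nxt_iterate j i
  rw [← hm, key]

/-- A non-constant `κ` differs at two positions at cyclic distance `≥ 2` (`n ≥ 5`): from an adjacent
disagreement `κ_q ≠ κ_{q+1}` compare both with `κ_{q+3}`. -/
theorem exists_far_pair_of_kap_ne (hn : 5 ≤ n) (A : Fin n → Fin n → Bool) {q : Fin n}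
    (h : kap A (nxt q) ≠ kap A q) :
    ∃ a b : Fin n, b ≠ prv a ∧ b ≠ a ∧ b ≠ nxt a ∧ kap A a ≠ kap A b := by
  have d2 : (nxt^[2]) (nxt q) ≠ nxt q := nxt_iterate_ne_self _ (by norm_num) (by omega)
  have d3 : (nxt^[3]) q ≠ q := nxt_iterate_ne_self _ (by norm_num) (by omega)
  have d3' : (nxt^[3]) (nxt q) ≠ nxt q := nxt_iterate_ne_self _ (by norm_num) (by omega)
  have d4 : (nxt^[4]) q ≠ q := nxt_iterate_ne_self _ (by norm_num) (by omega)
  have d1 : (nxt^[1]) (nxt q) ≠ nxt q := nxt_iterate_ne_self _ Nat.one_pos (by omega)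
  have d2q : (nxt^[2]) q ≠ q := nxt_iterate_ne_self _ (by norm_num) (by omega)
  by_cases hq : kap A (nxt (nxt (nxt q))) = kap A q
  · -- pair (q+1, q+3)
    refine ⟨nxt q, nxt (nxt (nxt q)), fun e => ?_, fun e => ?_, fun e => ?_, ?_⟩
    · rw [prv_nxt] at e; exact d3 e
    · exact d2 e
    · exact d1 (nxt_injective e)
    · rw [hq]; exact h
  · -- pair (q, q+3)
    refine ⟨q, nxt (nxt (nxt q)), fun e => ?_, fun e => ?_, fun e => ?_, fun e => hq e.symm⟩
    · exact d4 (by rw [show (nxt^[4]) q = nxt (nxt (nxt (nxt q))) from rfl, e, nxt_prv])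
    · exact d3 e
    · exact d2q (nxt_injective e)

/-! ### Step (4a): two particles with different κ -/

/-- **Step (4a).** Radius 1, two particles `a ≠ b` of `J(x)` with `κ_a ≠ κ_b`: the coin-pair flip at
`a, b` keeps the odd class and CHANGES the win bit. -/
theorem coinPair_flips (hn : 3 ≤ n) {A : Fin n → Fin n → Bool} (hR : IsRadiusOne A) (cv : Fin n → Bool)
    {a b : Fin n} (hab : a ≠ b) (hκ : kap A a ≠ kap A b) (x : Fin n → Bool) (hodd : IsOdd x)
    (ha : kline x a = false) (hb : kline x b = false) :
    IsOdd (flipAt x {a, b}) ∧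
      ¬ (Rel x (affineStrategy A cv x) ↔ Rel (flipAt x {a, b}) (affineStrategy A cv (flipAt x {a, b}))) := by
  obtain ⟨hodd', hJ⟩ := kline_flipPair hn x hodd hab ha hb
  refine ⟨hodd', ?_⟩
  have hc := kline_hardCore hn x hodd
  rw [rel_affine_iff hn A cv x hodd, rel_affine_iff hn A cv _ hodd', hJ, wval_flipAt, sum_pair hab,
    colSum_particle hn hR hc ha, colSum_particle hn hR hc hb, add_eq_one_of_ne _ _ hκ, add_one_eq_one_iff]
  tauto

/-! ### Steps (4b), (4c): the creation move -/

/-- **Steps (4b)/(4c).** Radius 1, on the cylinder `J_{s-2} = J_{s-1} = J_s = J_{s+1} = 1, J_{s+2} = b₀`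
with `e_s + κ_{s-1} + b₀·κ_{s+1} = 1`: the creation move at `s` (flip the bits `s-1, s+1`) keeps the odd
class and CHANGES the win bit.  (Win-bit change `= ⟨J, ∂b⟩ + b_s(x') = colSum_{s-1} + colSum_{s+1} + aff_s(x')`,
evaluated with the forcing equations `x_{s-1} = J_{s-2} ⊕ 1`, `x_s = 0`, `x_{s+1} = 1 ⊕ J_{s+2}`.) -/
theorem creation_flips (hn : 5 ≤ n) {A : Fin n → Fin n → Bool} (hR : IsRadiusOne A) (cv : Fin n → Bool)
    (s : Fin n) (b₀ : Bool) (hΔ : eps A cv s + kap A (prv s) + bitVal b₀ * kap A (nxt s) = 1)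
    (x : Fin n → Bool) (hodd : IsOdd x) (h1 : kline x (prv (prv s)) = true) (h2 : kline x (prv s) = true)
    (h3 : kline x s = true) (h4 : kline x (nxt s) = true) (h5 : kline x (nxt (nxt s)) = b₀) :
    IsOdd (flipAt x {prv s, nxt s}) ∧
      ¬ (Rel x (affineStrategy A cv x) ↔
          Rel (flipAt x {prv s, nxt s}) (affineStrategy A cv (flipAt x {prv s, nxt s}))) := by
  have hn3 : 3 ≤ n := by omega
  obtain ⟨hodd', hJ⟩ := kline_create (by omega) x hodd s h2 h3 h4
  refine ⟨hodd', ?_⟩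
  have dpn : prv s ≠ nxt s := prv_ne_nxt hn3 s
  have dns : nxt s ≠ s := nxt_ne_self (by omega) s
  have dps : prv s ≠ s := fun h => dns (prv_eq_iff.1 h).symm
  -- forcing equations
  have hxp : x (prv s) = !kline x (prv (prv s)) := by
    rw [apply_eq_of_kline hn3 x hodd (prv s) h2, nxt_prv, h3]; cases kline x (prv (prv s)) <;> rfl
  have hxs : x s = false := by rw [apply_eq_of_kline hn3 x hodd s h3, h2, h4]; rfl
  have hxn : x (nxt s) = !kline x (nxt (nxt s)) := by
    rw [apply_eq_of_kline hn3 x hodd (nxt s) h4, prv_nxt, h3]; cases kline x (nxt (nxt s)) <;> rfl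
  have hxp' : x (prv s) = false := by rw [hxp, h1]; rfl
  have hm1 : prv s ∈ ({prv s, nxt s} : Finset (Fin n)) := by simp
  have hm2 : s ∉ ({prv s, nxt s} : Finset (Fin n)) := by simp [dps.symm, dns.symm]
  have hm3 : nxt s ∈ ({prv s, nxt s} : Finset (Fin n)) := by simp
  have hb1 : bitVal true = 1 := rfl
  have hb0 : bitVal false = 0 := rfl
  have hnot : ∀ b : Bool, bitVal (!b) + 1 = bitVal b := by intro b; cases b <;> decide
  unfold eps kap at hΔ
  rw [nxt_prv, prv_nxt] at hΔ
  have hw' : wval A cv (flipAt (kline x) {s}) (flipAt x {prv s, nxt s}) = wval A cv (kline x) x + 1 := by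
    rw [wval_flipAt_left, wval_flipAt, sum_pair dpn, colSum_eq_three hn3 hR, colSum_eq_three hn3 hR,
      aff_eq_three hn3 hR]
    simp only [nxt_prv, prv_nxt, bitVal_flipAt, hm1, hm2, hm3, if_true, if_false, h1, h2, h3, h4, h5, hxp',
      hxs, hxn, hnot, hb1, hb0, add_zero, one_mul, mul_zero]
    linear_combination hΔ
  rw [rel_affine_iff hn3 A cv x hodd, rel_affine_iff hn3 A cv _ hodd', hJ, hw', add_one_eq_one_iff]
  tauto

/-! ### Step (4d): the NULL family in coefficient form -/

/-- The telescoping identity behind the NULL family, in coefficient form: for `𝔽₂`-valued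
`V, X` satisfying the kernel equations, `X(X+1) = 0`, `γ_k = α_{k+2}` and
`C_k = β_{k-1} + β_{k+1} + α_k + γ_k`: `Σ_k V_k (C_k + α_k X_{k-1} + β_k X_k + γ_k X_{k+1}) = 0`. -/
theorem null_sum (al be ga C V X : Fin n → ZMod 2)
    (hker : ∀ j, V (prv j) + V (nxt j) + X j * V j = 0) (hsq : ∀ j, X j * (X j + 1) = 0)
    (hga : ∀ k, ga k = al (nxt (nxt k))) (hC : ∀ k, C k = be (prv k) + be (nxt k) + al k + ga k) :
    ∑ k, V k * (C k + (al k * X (prv k) + be k * X k + ga k * X (nxt k))) = 0 := by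
  have hexp : ∀ k, V k * (C k + (al k * X (prv k) + be k * X k + ga k * X (nxt k))) =
      (V k * be k * X k + V k * al k * X (prv k) + V k * al k) + V k * be (prv k) + V k * be (nxt k) +
        (V k * al (nxt (nxt k)) * X (nxt k) + V k * al (nxt (nxt k))) := by
    intro k; rw [hC k, hga k]; ring
  rw [sum_congr rfl fun k _ => hexp k, sum_add_distrib, sum_add_distrib, sum_add_distrib]
  have h1 : ∑ j, V j * be (prv j) = ∑ i, V (nxt i) * be i := by
    rw [← nxt_bijective.sum_comp fun j => V j * be (prv j)]; simp only [prv_nxt]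
  have h2 : ∑ j, V j * be (nxt j) = ∑ i, V (prv i) * be i := by
    rw [← prv_bijective.sum_comp fun j => V j * be (nxt j)]; simp only [nxt_prv]
  have h3 : ∑ j, (V j * al (nxt (nxt j)) * X (nxt j) + V j * al (nxt (nxt j))) =
      ∑ i, (V (prv (prv i)) * al i * X (prv i) + V (prv (prv i)) * al i) := by
    rw [← (prv_bijective.comp prv_bijective).sum_comp fun j =>
      V j * al (nxt (nxt j)) * X (nxt j) + V j * al (nxt (nxt j))]
    simp only [Function.comp, nxt_prv]
  rw [h1, h2, h3, ← sum_add_distrib, ← sum_add_distrib, ← sum_add_distrib]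
  refine sum_eq_zero fun i _ => ?_
  have k0 := hker i
  have k1 := hker (prv i)
  rw [nxt_prv] at k1
  have sq := hsq (prv i)
  linear_combination be i * k0 + al i * (X (prv i) + 1) * k1 - al i * V (prv i) * sq

/-- **Step (4d).** Radius 1 with `κ ≡ 0` and `e ≡ 0`: the pairing `Σ_k v_k · aff_k(x)` vanishes for every
kernel vector `v ∈ K(x)` (the NULL family; `null_sum`). -/
theorem wval_null (hn : 3 ≤ n) {A : Fin n → Fin n → Bool} (hR : IsRadiusOne A) (cv : Fin n → Bool)
    (hκ : ∀ i, kap A i = 0) (he : ∀ s, eps A cv s = 0) {x v : Fin n → Bool} (hv : InKernel x v) :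
    wval A cv v x = 0 := by
  have h2 : ∀ a b : ZMod 2, a + b = 0 → a = b := by decide
  have h5 : ∀ a b c d e : ZMod 2, a + b + c + d + e = 0 → a = b + c + d + e := by decide
  unfold wval
  simp_rw [aff_eq_three hn hR]
  refine null_sum (fun j => bitVal (A j (prv j))) (fun j => bitVal (A j j)) (fun j => bitVal (A j (nxt j)))
    (fun j => bitVal (cv j)) (fun j => bitVal (v j)) (fun j => bitVal (x j)) (bitVal_kernel hv)
    (fun j => bitVal_mul_add_one (x j)) (fun k => ?_) (fun k => ?_)
  · have h := hκ (nxt k)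
    unfold kap at h
    rw [prv_nxt] at h
    simp only [prv_nxt]
    exact h2 _ _ h
  · have h := he k
    unfold eps at h
    exact h5 _ _ _ _ _ h

end Summit.QuantumAdvantage.AdviceFreeQNC0.Fib19
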